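import Summits.ValiantsHypothesis.ValiantsHypothesis.Theorems.LacunarySymmetroidMatrixDescartesPivotRankOneCriticalWindowsFourBranchMono
import Summits.ValiantsHypothesis.ValiantsHypothesis.Theorems.LacunarySymmetroidMatrixDescartesPivotRankOneCriticalWindowsFourCramer

/-!
# `MatrixDescartes` census — rank-one `(2,4)₁`, lone letter: THE BRANCH-0 FUNCTION (existence, uniqueness, strict monotonicity, continuity of the
# scale as a function of the direction along the `j`-free Cramer identity)

HONEST FRAMING.  Object-search cell `pub-symmetroid`, seat `val-sym-mdr-p1` (generation 22); helper file `--supports` the crux item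
stmt-ValiantsHypothesis-18050 (`Theses.LacunarySymmetroid.MatrixDescartes`, OPEN, on HOLD) with NO closure claim.  Fourth kernel piece of the `K = 4` lone-letter
programme (seat memo LONE-LETTER.md §8b–§8e): the analytic infrastructure every assembly of the law needs — the implicit «branch 0» `T ↦ x(T)` — WITHOUT the
implicit function theorem (monotonicity + intermediate values give continuity).  Companions `…FourCramer` (`scale_unique_of_branch0`, `critical_iff_cramer_four`),
`…FourBranchMono` (`branch0_scale_strictMono`).  No count is proved; nothing bears on `MatrixDescartes` in its window, on `DoorA26` / `DoorA34`, registers /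
credences, or `VP ≠ VNP`.

THE POINT (def-free; minors spelled out; `Tₘ` = any point `≥ t₀` past which the two window brackets are negative, e.g. the window edge).
* §1 `branch0_scale_exists` — for every direction `T` in the right window there is a scale `x > 0` with `w₀x^{d₀}(−M_{0j}) = wᵢx^{dᵢ}(−M_{ji}) + wₖx^{dₖ}(−M_{jk})`
  (intermediate value theorem on the normalised form `wᵢQx^{dᵢ−d₀} + wₖRx^{dₖ−d₀} = w₀P`). [folklore]
* **§2 `branch0_function`** — there is a function `φ` on `(Tₘ, tⱼ)`, positive, STRICTLY INCREASING and CONTINUOUS, such that `(x, T)` satisfies the `j`-free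
  Cramer identity iff `x = φ(T)`; in particular (with `critical_iff_cramer_four`) every critical point of the four-letter window profile on the lone letter's side
  lies on the graph of `φ`.  Continuity comes from `StrictMonoOn.continuousAt_of_exists_between`: intermediate scales are attained at intermediate directions
  (IVT in `T` for a fixed scale). [folklore]
[folklore] Intermediate value theorem, monotone-function continuity.  No definitions, no named facts.
-/

-- `Summit.ValiantsHypothesis.ValiantsHypothesis.…` repeats a component by the D-0017 layout
-- (single-conjunct summit), which the `dupNamespace` linter flags; the name is mandated.
set_option linter.dupNamespace false

namespace Summit.ValiantsHypothesis.ValiantsHypothesis.Theorems.LacunarySymmetroidMatrixDescartes.Pivot.CriticalWindows.Four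

open Summit.ValiantsHypothesis.ValiantsHypothesis.Theorems.LacunarySymmetroidMatrixDescartes.Pivot.CriticalWindows.Three

/-! ## 1. Existence of the scale for each direction -/

/-- **GENERIC EXISTENCE.**  For `p, q > 0`, `r ≥ 0` and `m n : ℕ` there is `x > 0` with `p = q·x^{m+1} + r·x^{n+1}`. [folklore] -/
theorem exists_scale_normalised {p q r : ℝ} (m n : ℕ) (hp : 0 < p) (hq : 0 < q) (hr : 0 ≤ r) :
    ∃ x : ℝ, 0 < x ∧ p = q * x ^ (m + 1) + r * x ^ (n + 1) := by
  set X : ℝ := max 1 (p / q) with hX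
  have hX1 : 1 ≤ X := le_max_left _ _
  have hXp : p / q ≤ X := le_max_right _ _
  have hcont : ContinuousOn (fun x : ℝ => q * x ^ (m + 1) + r * x ^ (n + 1)) (Set.Icc 0 X) := by fun_prop
  have h0 : (fun x : ℝ => q * x ^ (m + 1) + r * x ^ (n + 1)) 0 ≤ p := by
    simp; exact hp.le
  have h1 : p ≤ (fun x : ℝ => q * x ^ (m + 1) + r * x ^ (n + 1)) X := by
    simp only
    have hxpow : X ≤ X ^ (m + 1) := by
      calc X = X ^ 1 := (pow_one X).symm
        _ ≤ X ^ (m + 1) := pow_le_pow_right₀ hX1 (by omega)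
    have hqX : p ≤ q * X := by
      have := mul_le_mul_of_nonneg_left hXp hq.le
      rwa [mul_div_cancel₀ _ hq.ne'] at this
    have : q * X ≤ q * X ^ (m + 1) := mul_le_mul_of_nonneg_left hxpow hq.le
    have : 0 ≤ r * X ^ (n + 1) := by positivity
    linarith
  obtain ⟨x, ⟨hx0, -⟩, hx⟩ := intermediate_value_Icc (by positivity : (0 : ℝ) ≤ X) hcont ⟨h0, h1⟩
  simp only at hx
  have hxpos : 0 < x := by
    rcases lt_or_eq_of_le hx0 with h | h
    · exact h
    · exfalso; rw [← h] at hx; simp at hx; linarith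
  exact ⟨x, hxpos, hx.symm⟩

/-- **EXISTENCE OF THE BRANCH-0 SCALE.**  For `Tₘ < T < tⱼ` (both window brackets negative past `Tₘ`), positive weights and `d₀ < dᵢ, dₖ`, there is `x > 0`
with `w₀x^{d₀}(−M_{0j}(T)) = wᵢx^{dᵢ}(−M_{ji}(T)) + wₖx^{dₖ}(−M_{jk}(T))`. [folklore] -/
theorem branch0_scale_exists {a bi bk bj t₀ ti tk tj Tm T w₀ wi wk : ℝ} {d₀ di dk : ℕ}
    (ha : 0 < a) (hbi : 0 < bi) (hbk : 0 < bk) (hbj : 0 < bj) (hti : 0 < ti) (htk : 0 < tk) (hi0 : ti < t₀) (hk0 : tk < t₀)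
    (h0j : t₀ < tj) (hTm : t₀ ≤ Tm) (hQi : ∀ T : ℝ, Tm < T → (bj * (T + t₀) * (tj - T) - a * (T + tj) * (T - t₀)) < 0)
    (hw₀ : 0 < w₀) (hwi : 0 < wi) (hwk : 0 < wk) (h0i : d₀ < di) (h0k : d₀ < dk) (h1 : Tm < T) (h2 : T < tj) :
    ∃ x : ℝ, 0 < x ∧
      w₀ * x ^ d₀ * (-((T ^ (2:ℕ) - t₀ ^ (2:ℕ)) * (bj * (T - tj) ^ (2:ℕ)) - (T ^ (2:ℕ) - tj ^ (2:ℕ)) * (-a * (T - t₀) ^ (2:ℕ)))) = wi * x ^ di * (-((T ^ (2:ℕ) - tj ^ (2:ℕ)) * (bi * (T - ti) ^ (2:ℕ)) - (T ^ (2:ℕ) - ti ^ (2:ℕ)) * (bj * (T - tj) ^ (2:ℕ)))) + wk * x ^ dk * (-((T ^ (2:ℕ) - tj ^ (2:ℕ)) * (bk * (T - tk) ^ (2:ℕ)) - (T ^ (2:ℕ) - tk ^ (2:ℕ)) * (bj * (T - tj) ^ (2:ℕ)))) := by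
  obtain ⟨q0neg, -, -, -, -, -⟩ := bracket_signs ha hbi hbj hti hi0 h0j
  obtain ⟨q0negk, -, -, -, -, -⟩ := bracket_signs ha hbk hbj htk hk0 h0j
  obtain ⟨eji, e0j, -, -, -, -⟩ := minors_eq_neg_cross a bi bj t₀ ti tj T
  obtain ⟨ejk, -, -, -, -, -⟩ := minors_eq_neg_cross a bk bj t₀ tk tj T
  have hP : 0 < -((T ^ (2:ℕ) - t₀ ^ (2:ℕ)) * (bj * (T - tj) ^ (2:ℕ)) - (T ^ (2:ℕ) - tj ^ (2:ℕ)) * (-a * (T - t₀) ^ (2:ℕ))) := by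
    rw [e0j, neg_neg]; exact mul_pos_of_neg_of_neg (mul_neg_of_neg_of_pos (by linarith) (by linarith)) (hQi T h1)
  have hQ : 0 < -((T ^ (2:ℕ) - tj ^ (2:ℕ)) * (bi * (T - ti) ^ (2:ℕ)) - (T ^ (2:ℕ) - ti ^ (2:ℕ)) * (bj * (T - tj) ^ (2:ℕ))) := by
    rw [eji, neg_neg]; exact mul_pos_of_neg_of_neg (mul_neg_of_pos_of_neg (by linarith) (by linarith)) (q0neg T (by linarith) h2)
  have hR : 0 < -((T ^ (2:ℕ) - tj ^ (2:ℕ)) * (bk * (T - tk) ^ (2:ℕ)) - (T ^ (2:ℕ) - tk ^ (2:ℕ)) * (bj * (T - tj) ^ (2:ℕ))) := by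
    rw [ejk, neg_neg]; exact mul_pos_of_neg_of_neg (mul_neg_of_pos_of_neg (by linarith) (by linarith)) (q0negk T (by linarith) h2)
  obtain ⟨m, rfl⟩ := Nat.exists_eq_add_of_lt h0i
  obtain ⟨n, rfl⟩ := Nat.exists_eq_add_of_lt h0k
  obtain ⟨x, hx, ex⟩ := exists_scale_normalised m n (mul_pos hw₀ hP) (mul_pos hwi hQ) (mul_pos hwk hR).le
  refine ⟨x, hx, ?_⟩
  have e : w₀ * x ^ d₀ * (-((T ^ (2:ℕ) - t₀ ^ (2:ℕ)) * (bj * (T - tj) ^ (2:ℕ)) - (T ^ (2:ℕ) - tj ^ (2:ℕ)) * (-a * (T - t₀) ^ (2:ℕ)))) = (w₀ * (-((T ^ (2:ℕ) - t₀ ^ (2:ℕ)) * (bj * (T - tj) ^ (2:ℕ)) - (T ^ (2:ℕ) - tj ^ (2:ℕ)) * (-a * (T - t₀) ^ (2:ℕ))))) * x ^ d₀ := by ring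
  rw [e, ex]; ring

/-! ## 2. The branch-0 function -/

set_option maxHeartbeats 400000 in
-- one long bookkeeping proof (choice, monotonicity, two-sided intermediate scales); about twice the default budget
/-- **THE BRANCH-0 FUNCTION.**  Under the hypotheses of `branch0_scale_exists` there is `φ : ℝ → ℝ` with: `φ > 0` on `(Tₘ, tⱼ)`; the `j`-free Cramer identity
holds at `(φ T, T)`; any `x > 0` satisfying it at `T` equals `φ T`; `φ` is STRICTLY INCREASING and CONTINUOUS on `(Tₘ, tⱼ)`. [folklore] -/
theorem branch0_function {a bi bk bj t₀ ti tk tj Tm w₀ wi wk : ℝ} {d₀ di dk : ℕ}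
    (ha : 0 < a) (hbi : 0 < bi) (hbk : 0 < bk) (hbj : 0 < bj) (hti : 0 < ti) (htk : 0 < tk) (hi0 : ti < t₀) (hk0 : tk < t₀)
    (h0j : t₀ < tj) (hTm : t₀ ≤ Tm) (hQi : ∀ T : ℝ, Tm < T → (bj * (T + t₀) * (tj - T) - a * (T + tj) * (T - t₀)) < 0)
    (hw₀ : 0 < w₀) (hwi : 0 < wi) (hwk : 0 < wk) (h0i : d₀ < di) (h0k : d₀ < dk) :
    ∃ φ : ℝ → ℝ,
      (∀ T : ℝ, Tm < T → T < tj → 0 < φ T ∧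
        w₀ * (φ T) ^ d₀ * (-((T ^ (2:ℕ) - t₀ ^ (2:ℕ)) * (bj * (T - tj) ^ (2:ℕ)) - (T ^ (2:ℕ) - tj ^ (2:ℕ)) * (-a * (T - t₀) ^ (2:ℕ)))) = wi * (φ T) ^ di * (-((T ^ (2:ℕ) - tj ^ (2:ℕ)) * (bi * (T - ti) ^ (2:ℕ)) - (T ^ (2:ℕ) - ti ^ (2:ℕ)) * (bj * (T - tj) ^ (2:ℕ)))) + wk * (φ T) ^ dk * (-((T ^ (2:ℕ) - tj ^ (2:ℕ)) * (bk * (T - tk) ^ (2:ℕ)) - (T ^ (2:ℕ) - tk ^ (2:ℕ)) * (bj * (T - tj) ^ (2:ℕ))))) ∧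
      (∀ T x : ℝ, Tm < T → T < tj → 0 < x →
        w₀ * x ^ d₀ * (-((T ^ (2:ℕ) - t₀ ^ (2:ℕ)) * (bj * (T - tj) ^ (2:ℕ)) - (T ^ (2:ℕ) - tj ^ (2:ℕ)) * (-a * (T - t₀) ^ (2:ℕ)))) = wi * x ^ di * (-((T ^ (2:ℕ) - tj ^ (2:ℕ)) * (bi * (T - ti) ^ (2:ℕ)) - (T ^ (2:ℕ) - ti ^ (2:ℕ)) * (bj * (T - tj) ^ (2:ℕ)))) + wk * x ^ dk * (-((T ^ (2:ℕ) - tj ^ (2:ℕ)) * (bk * (T - tk) ^ (2:ℕ)) - (T ^ (2:ℕ) - tk ^ (2:ℕ)) * (bj * (T - tj) ^ (2:ℕ)))) → x = φ T) ∧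
      StrictMonoOn φ (Set.Ioo Tm tj) ∧ ContinuousOn φ (Set.Ioo Tm tj) := by
  have hex : ∀ T : ℝ, ∃ x : ℝ, Tm < T → T < tj → (0 < x ∧
      w₀ * x ^ d₀ * (-((T ^ (2:ℕ) - t₀ ^ (2:ℕ)) * (bj * (T - tj) ^ (2:ℕ)) - (T ^ (2:ℕ) - tj ^ (2:ℕ)) * (-a * (T - t₀) ^ (2:ℕ)))) = wi * x ^ di * (-((T ^ (2:ℕ) - tj ^ (2:ℕ)) * (bi * (T - ti) ^ (2:ℕ)) - (T ^ (2:ℕ) - ti ^ (2:ℕ)) * (bj * (T - tj) ^ (2:ℕ)))) + wk * x ^ dk * (-((T ^ (2:ℕ) - tj ^ (2:ℕ)) * (bk * (T - tk) ^ (2:ℕ)) - (T ^ (2:ℕ) - tk ^ (2:ℕ)) * (bj * (T - tj) ^ (2:ℕ))))) := by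
    intro T
    by_cases h : Tm < T ∧ T < tj
    · obtain ⟨x, hx, ex⟩ := branch0_scale_exists ha hbi hbk hbj hti htk hi0 hk0 h0j hTm hQi hw₀ hwi hwk h0i h0k h.1 h.2
      exact ⟨x, fun _ _ => ⟨hx, ex⟩⟩
    · exact ⟨1, fun h1 h2 => absurd ⟨h1, h2⟩ h⟩
  choose φ hφ using hex
  -- uniqueness of the scale for a given direction
  obtain ⟨q0neg, -, -, -, -, -⟩ := bracket_signs ha hbi hbj hti hi0 h0j
  obtain ⟨q0negk, -, -, -, -, -⟩ := bracket_signs ha hbk hbj htk hk0 h0j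
  have signs : ∀ T : ℝ, Tm < T → T < tj → 0 < -((T ^ (2:ℕ) - t₀ ^ (2:ℕ)) * (bj * (T - tj) ^ (2:ℕ)) - (T ^ (2:ℕ) - tj ^ (2:ℕ)) * (-a * (T - t₀) ^ (2:ℕ))) ∧ 0 < -((T ^ (2:ℕ) - tj ^ (2:ℕ)) * (bi * (T - ti) ^ (2:ℕ)) - (T ^ (2:ℕ) - ti ^ (2:ℕ)) * (bj * (T - tj) ^ (2:ℕ))) ∧ 0 < -((T ^ (2:ℕ) - tj ^ (2:ℕ)) * (bk * (T - tk) ^ (2:ℕ)) - (T ^ (2:ℕ) - tk ^ (2:ℕ)) * (bj * (T - tj) ^ (2:ℕ))) := by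
    intro T h1 h2
    obtain ⟨eji, e0j, -, -, -, -⟩ := minors_eq_neg_cross a bi bj t₀ ti tj T
    obtain ⟨ejk, -, -, -, -, -⟩ := minors_eq_neg_cross a bk bj t₀ tk tj T
    refine ⟨?_, ?_, ?_⟩
    · rw [e0j, neg_neg]; exact mul_pos_of_neg_of_neg (mul_neg_of_neg_of_pos (by linarith) (by linarith)) (hQi T h1)
    · rw [eji, neg_neg]; exact mul_pos_of_neg_of_neg (mul_neg_of_pos_of_neg (by linarith) (by linarith)) (q0neg T (by linarith) h2)
    · rw [ejk, neg_neg]; exact mul_pos_of_neg_of_neg (mul_neg_of_pos_of_neg (by linarith) (by linarith)) (q0negk T (by linarith) h2)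
  have uniq : ∀ T x : ℝ, Tm < T → T < tj → 0 < x →
      w₀ * x ^ d₀ * (-((T ^ (2:ℕ) - t₀ ^ (2:ℕ)) * (bj * (T - tj) ^ (2:ℕ)) - (T ^ (2:ℕ) - tj ^ (2:ℕ)) * (-a * (T - t₀) ^ (2:ℕ)))) = wi * x ^ di * (-((T ^ (2:ℕ) - tj ^ (2:ℕ)) * (bi * (T - ti) ^ (2:ℕ)) - (T ^ (2:ℕ) - ti ^ (2:ℕ)) * (bj * (T - tj) ^ (2:ℕ)))) + wk * x ^ dk * (-((T ^ (2:ℕ) - tj ^ (2:ℕ)) * (bk * (T - tk) ^ (2:ℕ)) - (T ^ (2:ℕ) - tk ^ (2:ℕ)) * (bj * (T - tj) ^ (2:ℕ)))) → x = φ T := by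
    intro T x h1 h2 hx ex
    obtain ⟨hφ1, eφ⟩ := hφ T h1 h2
    obtain ⟨hP, hQ, hR⟩ := signs T h1 h2
    have ex' : (w₀ * (-((T ^ (2:ℕ) - t₀ ^ (2:ℕ)) * (bj * (T - tj) ^ (2:ℕ)) - (T ^ (2:ℕ) - tj ^ (2:ℕ)) * (-a * (T - t₀) ^ (2:ℕ))))) * x ^ d₀ = (wi * (-((T ^ (2:ℕ) - tj ^ (2:ℕ)) * (bi * (T - ti) ^ (2:ℕ)) - (T ^ (2:ℕ) - ti ^ (2:ℕ)) * (bj * (T - tj) ^ (2:ℕ))))) * x ^ di + (wk * (-((T ^ (2:ℕ) - tj ^ (2:ℕ)) * (bk * (T - tk) ^ (2:ℕ)) - (T ^ (2:ℕ) - tk ^ (2:ℕ)) * (bj * (T - tj) ^ (2:ℕ))))) * x ^ dk := by linear_combination ex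
    have eφ' : (w₀ * (-((T ^ (2:ℕ) - t₀ ^ (2:ℕ)) * (bj * (T - tj) ^ (2:ℕ)) - (T ^ (2:ℕ) - tj ^ (2:ℕ)) * (-a * (T - t₀) ^ (2:ℕ))))) * (φ T) ^ d₀ = (wi * (-((T ^ (2:ℕ) - tj ^ (2:ℕ)) * (bi * (T - ti) ^ (2:ℕ)) - (T ^ (2:ℕ) - ti ^ (2:ℕ)) * (bj * (T - tj) ^ (2:ℕ))))) * (φ T) ^ di + (wk * (-((T ^ (2:ℕ) - tj ^ (2:ℕ)) * (bk * (T - tk) ^ (2:ℕ)) - (T ^ (2:ℕ) - tk ^ (2:ℕ)) * (bj * (T - tj) ^ (2:ℕ))))) * (φ T) ^ dk := by linear_combination eφ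
    exact scale_unique_of_branch0 (mul_pos hwi hQ) (mul_pos hwk hR) h0i h0k hx hφ1 ex' eφ'
  -- strict monotonicity (kernel: `branch0_scale_strictMono`)
  have mono : StrictMonoOn φ (Set.Ioo Tm tj) := by
    intro T₁ hT₁ T₂ hT₂ h12
    obtain ⟨p1, e1⟩ := hφ T₁ hT₁.1 hT₁.2
    obtain ⟨p2, e2⟩ := hφ T₂ hT₂.1 hT₂.2
    exact branch0_scale_strictMono ha hbi hbk hbj hti htk hi0 hk0 h0j hTm hQi hQi hwi hwk h0i h0k p1 p2 hT₁.1 h12 hT₂.2 e1 e2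
  refine ⟨φ, fun T h1 h2 => hφ T h1 h2, uniq, mono, ?_⟩
  -- continuity: intermediate scales are attained at intermediate directions
  obtain ⟨m, rfl⟩ := Nat.exists_eq_add_of_lt h0i
  obtain ⟨n, rfl⟩ := Nat.exists_eq_add_of_lt h0k
  -- the identity at (x, T) in normalised form `G T x = 0`
  have Gcont : ∀ x : ℝ, Continuous (fun T : ℝ =>
      wi * (-((T ^ (2:ℕ) - tj ^ (2:ℕ)) * (bi * (T - ti) ^ (2:ℕ)) - (T ^ (2:ℕ) - ti ^ (2:ℕ)) * (bj * (T - tj) ^ (2:ℕ)))) * x ^ (m + 1) + wk * (-((T ^ (2:ℕ) - tj ^ (2:ℕ)) * (bk * (T - tk) ^ (2:ℕ)) - (T ^ (2:ℕ) - tk ^ (2:ℕ)) * (bj * (T - tj) ^ (2:ℕ)))) * x ^ (n + 1) - w₀ * (-((T ^ (2:ℕ) - t₀ ^ (2:ℕ)) * (bj * (T - tj) ^ (2:ℕ)) - (T ^ (2:ℕ) - tj ^ (2:ℕ)) * (-a * (T - t₀) ^ (2:ℕ))))) := by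
    intro x; fun_prop
  have Gzero_iff : ∀ T x : ℝ, Tm < T → T < tj → 0 < x →
      (wi * (-((T ^ (2:ℕ) - tj ^ (2:ℕ)) * (bi * (T - ti) ^ (2:ℕ)) - (T ^ (2:ℕ) - ti ^ (2:ℕ)) * (bj * (T - tj) ^ (2:ℕ)))) * x ^ (m + 1) + wk * (-((T ^ (2:ℕ) - tj ^ (2:ℕ)) * (bk * (T - tk) ^ (2:ℕ)) - (T ^ (2:ℕ) - tk ^ (2:ℕ)) * (bj * (T - tj) ^ (2:ℕ)))) * x ^ (n + 1) - w₀ * (-((T ^ (2:ℕ) - t₀ ^ (2:ℕ)) * (bj * (T - tj) ^ (2:ℕ)) - (T ^ (2:ℕ) - tj ^ (2:ℕ)) * (-a * (T - t₀) ^ (2:ℕ)))) = 0 ↔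
       w₀ * x ^ d₀ * (-((T ^ (2:ℕ) - t₀ ^ (2:ℕ)) * (bj * (T - tj) ^ (2:ℕ)) - (T ^ (2:ℕ) - tj ^ (2:ℕ)) * (-a * (T - t₀) ^ (2:ℕ)))) = wi * x ^ (d₀ + m + 1) * (-((T ^ (2:ℕ) - tj ^ (2:ℕ)) * (bi * (T - ti) ^ (2:ℕ)) - (T ^ (2:ℕ) - ti ^ (2:ℕ)) * (bj * (T - tj) ^ (2:ℕ)))) + wk * x ^ (d₀ + n + 1) * (-((T ^ (2:ℕ) - tj ^ (2:ℕ)) * (bk * (T - tk) ^ (2:ℕ)) - (T ^ (2:ℕ) - tk ^ (2:ℕ)) * (bj * (T - tj) ^ (2:ℕ))))) := by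
    intro T x h1 h2 hx
    have hxd : x ^ d₀ ≠ 0 := pow_ne_zero _ hx.ne'
    constructor
    · intro h
      have : (wi * (-((T ^ (2:ℕ) - tj ^ (2:ℕ)) * (bi * (T - ti) ^ (2:ℕ)) - (T ^ (2:ℕ) - ti ^ (2:ℕ)) * (bj * (T - tj) ^ (2:ℕ)))) * x ^ (m + 1) + wk * (-((T ^ (2:ℕ) - tj ^ (2:ℕ)) * (bk * (T - tk) ^ (2:ℕ)) - (T ^ (2:ℕ) - tk ^ (2:ℕ)) * (bj * (T - tj) ^ (2:ℕ)))) * x ^ (n + 1) - w₀ * (-((T ^ (2:ℕ) - t₀ ^ (2:ℕ)) * (bj * (T - tj) ^ (2:ℕ)) - (T ^ (2:ℕ) - tj ^ (2:ℕ)) * (-a * (T - t₀) ^ (2:ℕ))))) * x ^ d₀ = 0 := by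
        rw [h, zero_mul]
      linear_combination (-1 : ℝ) * this
    · intro h
      have e : (wi * (-((T ^ (2:ℕ) - tj ^ (2:ℕ)) * (bi * (T - ti) ^ (2:ℕ)) - (T ^ (2:ℕ) - ti ^ (2:ℕ)) * (bj * (T - tj) ^ (2:ℕ)))) * x ^ (m + 1) + wk * (-((T ^ (2:ℕ) - tj ^ (2:ℕ)) * (bk * (T - tk) ^ (2:ℕ)) - (T ^ (2:ℕ) - tk ^ (2:ℕ)) * (bj * (T - tj) ^ (2:ℕ)))) * x ^ (n + 1) - w₀ * (-((T ^ (2:ℕ) - t₀ ^ (2:ℕ)) * (bj * (T - tj) ^ (2:ℕ)) - (T ^ (2:ℕ) - tj ^ (2:ℕ)) * (-a * (T - t₀) ^ (2:ℕ))))) * x ^ d₀ = 0 * x ^ d₀ := by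
        linear_combination (-1 : ℝ) * h
      exact mul_right_cancel₀ hxd e
  -- sign of `G T x` compared with the branch: increasing in `x`
  have Gsign : ∀ T x : ℝ, Tm < T → T < tj → 0 < x →
      (x < φ T → wi * (-((T ^ (2:ℕ) - tj ^ (2:ℕ)) * (bi * (T - ti) ^ (2:ℕ)) - (T ^ (2:ℕ) - ti ^ (2:ℕ)) * (bj * (T - tj) ^ (2:ℕ)))) * x ^ (m + 1) + wk * (-((T ^ (2:ℕ) - tj ^ (2:ℕ)) * (bk * (T - tk) ^ (2:ℕ)) - (T ^ (2:ℕ) - tk ^ (2:ℕ)) * (bj * (T - tj) ^ (2:ℕ)))) * x ^ (n + 1) - w₀ * (-((T ^ (2:ℕ) - t₀ ^ (2:ℕ)) * (bj * (T - tj) ^ (2:ℕ)) - (T ^ (2:ℕ) - tj ^ (2:ℕ)) * (-a * (T - t₀) ^ (2:ℕ)))) < 0) ∧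
      (φ T < x → 0 < wi * (-((T ^ (2:ℕ) - tj ^ (2:ℕ)) * (bi * (T - ti) ^ (2:ℕ)) - (T ^ (2:ℕ) - ti ^ (2:ℕ)) * (bj * (T - tj) ^ (2:ℕ)))) * x ^ (m + 1) + wk * (-((T ^ (2:ℕ) - tj ^ (2:ℕ)) * (bk * (T - tk) ^ (2:ℕ)) - (T ^ (2:ℕ) - tk ^ (2:ℕ)) * (bj * (T - tj) ^ (2:ℕ)))) * x ^ (n + 1) - w₀ * (-((T ^ (2:ℕ) - t₀ ^ (2:ℕ)) * (bj * (T - tj) ^ (2:ℕ)) - (T ^ (2:ℕ) - tj ^ (2:ℕ)) * (-a * (T - t₀) ^ (2:ℕ))))) := by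
    intro T x h1 h2 hx
    obtain ⟨hφ1, eφ⟩ := hφ T h1 h2
    obtain ⟨hP, hQ, hR⟩ := signs T h1 h2
    have e0 : wi * (-((T ^ (2:ℕ) - tj ^ (2:ℕ)) * (bi * (T - ti) ^ (2:ℕ)) - (T ^ (2:ℕ) - ti ^ (2:ℕ)) * (bj * (T - tj) ^ (2:ℕ)))) * (φ T) ^ (m + 1) + wk * (-((T ^ (2:ℕ) - tj ^ (2:ℕ)) * (bk * (T - tk) ^ (2:ℕ)) - (T ^ (2:ℕ) - tk ^ (2:ℕ)) * (bj * (T - tj) ^ (2:ℕ)))) * (φ T) ^ (n + 1) - w₀ * (-((T ^ (2:ℕ) - t₀ ^ (2:ℕ)) * (bj * (T - tj) ^ (2:ℕ)) - (T ^ (2:ℕ) - tj ^ (2:ℕ)) * (-a * (T - t₀) ^ (2:ℕ)))) = 0 :=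
      (Gzero_iff T (φ T) h1 h2 hφ1).mpr eφ
    constructor
    · intro hlt
      have p1 : x ^ (m + 1) < (φ T) ^ (m + 1) := pow_lt_pow_left₀ hlt hx.le (Nat.succ_ne_zero m)
      have p2 : x ^ (n + 1) < (φ T) ^ (n + 1) := pow_lt_pow_left₀ hlt hx.le (Nat.succ_ne_zero n)
      have := mul_lt_mul_of_pos_left p1 (mul_pos hwi hQ)
      have := mul_lt_mul_of_pos_left p2 (mul_pos hwk hR)
      linarith
    · intro hlt
      have p1 : (φ T) ^ (m + 1) < x ^ (m + 1) := pow_lt_pow_left₀ hlt hφ1.le (Nat.succ_ne_zero m)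
      have p2 : (φ T) ^ (n + 1) < x ^ (n + 1) := pow_lt_pow_left₀ hlt hφ1.le (Nat.succ_ne_zero n)
      have := mul_lt_mul_of_pos_left p1 (mul_pos hwi hQ)
      have := mul_lt_mul_of_pos_left p2 (mul_pos hwk hR)
      linarith
  -- an intermediate scale x' strictly between φ T₁ and φ T₂ is attained at some direction strictly between
  have attain : ∀ T₁ T₂ x' : ℝ, Tm < T₁ → T₁ < T₂ → T₂ < tj → φ T₁ < x' → x' < φ T₂ →
      ∃ c : ℝ, T₁ < c ∧ c < T₂ ∧ φ c = x' := by
    intro T₁ T₂ x' h1 h12 h2 hx1 hx2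
    have hx' : 0 < x' := lt_trans (hφ T₁ h1 (by linarith)).1 hx1
    have s1 := ((Gsign T₁ x' h1 (by linarith) hx').2 hx1)
    have s2 := ((Gsign T₂ x' (by linarith) h2 hx').1 hx2)
    obtain ⟨c, ⟨hc1, hc2⟩, hc⟩ := intermediate_value_Ioo' (le_of_lt h12) ((Gcont x').continuousOn) ⟨s2, s1⟩
    refine ⟨c, hc1, hc2, ?_⟩
    have hcT : Tm < c ∧ c < tj := ⟨by linarith, by linarith⟩
    exact (uniq c x' hcT.1 hcT.2 hx' ((Gzero_iff c x' hcT.1 hcT.2 hx').mp hc)).symm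
  -- continuity at every point of the open interval
  apply continuousOn_of_forall_continuousAt
  intro T hT
  obtain ⟨h1, h2⟩ := hT
  refine mono.continuousAt_of_exists_between (Ioo_mem_nhds h1 h2) ?_ ?_
  · -- values slightly below `φ T`
    intro b hb
    obtain ⟨T', hT'1, hT'2⟩ : ∃ T' : ℝ, Tm < T' ∧ T' < T := ⟨(Tm + T) / 2, by linarith, by linarith⟩
    have hlt : φ T' < φ T := mono ⟨hT'1, by linarith⟩ ⟨h1, h2⟩ hT'2
    by_cases hb' : b < φ T'
    · exact ⟨T', ⟨hT'1, by linarith⟩, hb'.le, hlt⟩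
    · push Not at hb'
      obtain ⟨c, hc1, hc2, hc⟩ := attain T' T ((b + φ T) / 2) hT'1 hT'2 h2 (by linarith) (by linarith)
      exact ⟨c, ⟨by linarith, by linarith⟩, by rw [hc]; constructor <;> linarith⟩
  · -- values slightly above `φ T`
    intro b hb
    obtain ⟨T', hT'1, hT'2⟩ : ∃ T' : ℝ, T < T' ∧ T' < tj := ⟨(T + tj) / 2, by linarith, by linarith⟩
    have hlt : φ T < φ T' := mono ⟨h1, h2⟩ ⟨by linarith, hT'2⟩ hT'1
    by_cases hb' : φ T' < b
    · exact ⟨T', ⟨by linarith, hT'2⟩, hlt, hb'.le⟩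
    · push Not at hb'
      obtain ⟨c, hc1, hc2, hc⟩ := attain T T' ((φ T + b) / 2) h1 hT'1 hT'2 (by linarith) (by linarith)
      exact ⟨c, ⟨by linarith, by linarith⟩, by rw [hc]; constructor <;> linarith⟩

end Summit.ValiantsHypothesis.ValiantsHypothesis.Theorems.LacunarySymmetroidMatrixDescartes.Pivot.CriticalWindows.Four
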